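import Summits.QuantumFields.YangMills.Theorems.UnitScaleTiltProp7SymAvgTwSymDefs
import Summits.QuantumFields.YangMills.Theorems.UnitScaleTiltProp7SymAvgTwFrameAxial
import HarnessLib

/-!
# Route `UnitScaleTilt`, crux K1 «MinimiserStabilityRegPr» (stmt-QuantumFields-19200), route-R E′ (A′)-on-Σ, P-A2-COMB row (β) (★p1 g17 WORD 23 (b) «px18 g3: (β) GO — COMB := SYM ∘ coarse frame
# change») — file (β-i): **THE EXACT COMB–SYMMETRIC CONJUGATION IDENTITY** — the comb-framed twisted double bar `U̿^{tw}` ([Balaban1985Averaging] (89)–(92) with the CORNER-comb frames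
# `frameTw = wrec`) IS the symmetric-framed one `U̿^{twS}` (frames `frameTwS`) CONJUGATED by the coarse-site frame ratio `g := frameTw⁻¹·frameTwS` (left at `c₋`, `Ad_{D̄(U₀)(c)}(g⁻¹)` at `c₊`):
# both charts average the SAME descended field `D̄_GL(e^{A}U₀)(c)·D̄_GL(U₀)(c)⁻¹`, so `CmapTw − CmapTwS` is the BCH second-order expression in `(log g, log U̿^{twS})` — the door (β-ii) is the sequel

Cell `ym3-torus` (HUMAN RULING D-0037: YM₃ on the torus is ladder rung R3 — not d = 4, not a mass gap, not Clay), width seat `ym3-torus-px18` (gen 3).  `--supports stmt-QuantumFields-19200 --as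
helper`; THEOREMS ONLY (0 `def`, 0 `sorry`); count-neutral.  Pure algebra over the two definition files ✓`Prop7SymAvgTwDefs` (comb) and ✓`Prop7SymAvgTwSymDefs` (symmetric); nothing of P-A2,
hcoS, E′, EX, the crux, d = 4 or the mass gap is claimed.

THE PRINT.  [Balaban1985Averaging] p. 31 (89)–(92): «(\overline{\overline{R(V₀)V₁}})_c = (\overline{R_{0,c₋}V₁})⁻¹(\overline{V₁V₀})_c(V̄₀)_c⁻¹R̄_{0,c}\overline{R_{0,c₊}V₁}» — the double bar is the
single bar of the full field gauge-transformed at the coarse sites by the block frames; two frame choices (corner comb (82) vs the route's centred symmetric family, OWNER RULING g26-№12) differ by a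
COARSE gauge transformation `g(y) = w_c(y)⁻¹w_s(y)`; [Balaban1985Variational] (44) p. 285 (`C = log U̿ − Q·`).

WHAT IS PROVED (ns `…Theorems.Prop7CombSymConjugation`; `g A y := (frameTw F n K h U₀ A y)⁻¹ * frameTwS F n K h U₀ A y`, `D₀ c := descendToGL F n K h (bgUnits F K U₀) c`).
* ★★ `dbarTw_eq_conj_dbarTwS` — `dbarTw U₀ A c = g A c₋ · dbarTwS U₀ A c · (D₀ c · (g A c₊)⁻¹ · (D₀ c)⁻¹)` in `(M₂)ˣ` (EXACT, every `A`, every `U₀`).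
* `frameRatio_zero` (`g 0 y = 1`), `conjTgt_zero` (`D₀ c·(g 0 c₊)⁻¹·(D₀ c)⁻¹ = 1`) — at the origin both conjugating factors are `1` (✓`frameTw_zero`, ✓`frameTwS_zero`).
* ★ `logChartTw_eq_mlog_conj` — `logChartTw U₀ A c = mlog( ↑(g A c₋) · ↑(dbarTwS U₀ A c) · ↑(D₀ c·(g A c₊)⁻¹·(D₀ c)⁻¹) )`.
* ★ `CmapTw_sub_CmapTwS_eq` — `CmapTw U₀ A c − CmapTwS U₀ A c = [mlog(↑g₋·↑U̿^{twS}·↑h₊) − mlog ↑U̿^{twS}] − [QTw U₀ A c − QTwS U₀ A c]` (the shape the BCH door (β-ii) bounds: the first bracket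
  minus its linear part, the second bracket being exactly that linear part by ✓P-A1's LEG lemmas `QTw − QTwS = −(r_c − r_s)`-terms).
HONEST SCOPE.  Algebra; no estimate.  The difference row `Σ_c‖CmapTw(iX)c − CmapTwS(iX)c‖ ≤ C₁′ℓ⁻¹M + C₂′ℓ(K + dv)` (WORD 23 (b)) is NOT proved here.

References: T. Bałaban, CMP **98** (1985) 17–51 [Balaban1985Averaging] ((82) p.30, (89)–(92) p.31, (97) p.32); CMP **99** (1985) 75–102 [Balaban1985RegularSpaces] ((1.30)–(1.31) pp.81–82);
CMP **102** (1985) 277–309 [Balaban1985Variational] ((44) p.285).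
-/

set_option autoImplicit false

noncomputable section

open scoped Matrix.Norms.L2Operator

namespace Summit.QuantumFields.YangMills.Theorems.Prop7CombSymConjugation

open Literature.MathematicalPhysics.QuantumFieldTheory.Balaban1983to89
open Literature.MathematicalPhysics.QuantumFieldTheory.Balaban1983to89.T3ContinuumYM3Torus
open MatrixLog (mlog)
open B7Prop1Explicit (expUnit)
open T3SectALandauChart (bgUnits)
open Summit.QuantumFields.YangMills.Theorems.Prop7SymAvgGL (descendToGL)
open Summit.QuantumFields.YangMills.Theorems.Prop7SymAvgTw (frameTw dbarTw dbarTw_def logChartTw logChartTw_apply QTw CmapTw CmapTw_apply)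
open Summit.QuantumFields.YangMills.Theorems.Prop7SymAvgTwSym (frameTwS dbarTwS dbarTwS_def logChartTwS logChartTwS_apply QTwS CmapTwS CmapTwS_apply frameTwS_zero)
open Summit.QuantumFields.YangMills.Theorems.Prop7SymAvgTwFrameAxial (frameTw_zero)

variable (F : T3Family) (n K : ℕ) (h : n ≤ K) (U₀ : GaugeField (F.P K) 0 (Matrix.specialUnitaryGroup (Fin 2) ℂ))

/-- ★★ **THE EXACT COMB–SYMMETRIC CONJUGATION**: `U̿^{tw}(A)(c) = g(c₋) · U̿^{twS}(A)(c) · (D̄₀(c)·g(c₊)⁻¹·D̄₀(c)⁻¹)` with the coarse-site frame ratio `g(y) := w_c(y)⁻¹·w_s(y)` — both double bars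
are `frame(c₋)⁻¹ · D̄(e^{A}U₀)(c) · frame(c₊) · D̄(U₀)(c)⁻¹` with the SAME descended fields. [cite: Balaban1985Averaging, (89)–(92) p.31] -/
theorem dbarTw_eq_conj_dbarTwS (A : PBond (F.P K) 0 → Matrix (Fin 2) (Fin 2) ℂ) (c : PBond (F.P n) 0) :
    dbarTw F n K h U₀ A c =
      ((frameTw F n K h U₀ A c.src)⁻¹ * frameTwS F n K h U₀ A c.src) * dbarTwS F n K h U₀ A c *
        (descendToGL F n K h (bgUnits F K U₀) c * ((frameTw F n K h U₀ A c.tgt)⁻¹ * frameTwS F n K h U₀ A c.tgt)⁻¹ * (descendToGL F n K h (bgUnits F K U₀) c)⁻¹) := by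
  rw [dbarTw_def, dbarTwS_def]
  group

/-- At the origin the frame ratio is `1`. [cite: Balaban1985Averaging, (82) p.30, (97) p.32] -/
theorem frameRatio_zero (y : Site (F.P n) 0) : (frameTw F n K h U₀ 0 y)⁻¹ * frameTwS F n K h U₀ 0 y = 1 := by
  rw [frameTw_zero, frameTwS_zero, inv_one, one_mul]

/-- At the origin the right conjugating factor is `1`. [cite: Balaban1985Averaging, (89) p.31] -/
theorem conjTgt_zero (c : PBond (F.P n) 0) :
    descendToGL F n K h (bgUnits F K U₀) c * ((frameTw F n K h U₀ 0 c.tgt)⁻¹ * frameTwS F n K h U₀ 0 c.tgt)⁻¹ * (descendToGL F n K h (bgUnits F K U₀) c)⁻¹ = 1 := by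
  rw [frameRatio_zero, inv_one, mul_one, mul_inv_cancel]

/-- ★ **THE COMB LOG-CHART IS THE `log` OF THE CONJUGATED SYMMETRIC DOUBLE BAR.** [cite: Balaban1985RegularSpaces, (1.31) p.82; Balaban1985Averaging, (89)–(92) p.31] -/
theorem logChartTw_eq_mlog_conj (A : PBond (F.P K) 0 → Matrix (Fin 2) (Fin 2) ℂ) (c : PBond (F.P n) 0) :
    logChartTw F n K h U₀ A c =
      mlog ((((frameTw F n K h U₀ A c.src)⁻¹ * frameTwS F n K h U₀ A c.src : (Matrix (Fin 2) (Fin 2) ℂ)ˣ) : Matrix (Fin 2) (Fin 2) ℂ) *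
        ((dbarTwS F n K h U₀ A c : (Matrix (Fin 2) (Fin 2) ℂ)ˣ) : Matrix (Fin 2) (Fin 2) ℂ) *
        ((descendToGL F n K h (bgUnits F K U₀) c * ((frameTw F n K h U₀ A c.tgt)⁻¹ * frameTwS F n K h U₀ A c.tgt)⁻¹ * (descendToGL F n K h (bgUnits F K U₀) c)⁻¹ :
          (Matrix (Fin 2) (Fin 2) ℂ)ˣ) : Matrix (Fin 2) (Fin 2) ℂ)) := by
  rw [logChartTw_apply, dbarTw_eq_conj_dbarTwS, Units.val_mul, Units.val_mul]

/-- ★ **THE DIFFERENCE OF THE TWO CHART REMAINDERS**: `C^{tw}(A)(c) − C^{twS}(A)(c) = [log(g₋·U̿^{twS}·h₊) − log U̿^{twS}] − [Q^{tw}A − Q^{twS}A](c)` — the first bracket is the conjugation's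
effect on the logarithm, the second its linear part (✓P-A1 LEG: `QTw − QTwS` = the frame-response difference terms); the BCH door (β-ii) bounds «first bracket minus second» at second order.
[cite: Balaban1985Variational, (44) p.285; Balaban1985Averaging, (89)–(92) p.31] -/
theorem CmapTw_sub_CmapTwS_eq (A : PBond (F.P K) 0 → Matrix (Fin 2) (Fin 2) ℂ) (c : PBond (F.P n) 0) :
    CmapTw F n K h U₀ A c - CmapTwS F n K h U₀ A c =
      (mlog ((((frameTw F n K h U₀ A c.src)⁻¹ * frameTwS F n K h U₀ A c.src : (Matrix (Fin 2) (Fin 2) ℂ)ˣ) : Matrix (Fin 2) (Fin 2) ℂ) *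
          ((dbarTwS F n K h U₀ A c : (Matrix (Fin 2) (Fin 2) ℂ)ˣ) : Matrix (Fin 2) (Fin 2) ℂ) *
          ((descendToGL F n K h (bgUnits F K U₀) c * ((frameTw F n K h U₀ A c.tgt)⁻¹ * frameTwS F n K h U₀ A c.tgt)⁻¹ * (descendToGL F n K h (bgUnits F K U₀) c)⁻¹ :
            (Matrix (Fin 2) (Fin 2) ℂ)ˣ) : Matrix (Fin 2) (Fin 2) ℂ))
        - mlog ((dbarTwS F n K h U₀ A c : (Matrix (Fin 2) (Fin 2) ℂ)ˣ) : Matrix (Fin 2) (Fin 2) ℂ))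
      - (QTw F n K h U₀ A c - QTwS F n K h U₀ A c) := by
  rw [CmapTw_apply, CmapTwS_apply, Pi.sub_apply, Pi.sub_apply, logChartTw_eq_mlog_conj, logChartTwS_apply]
  abel

end Summit.QuantumFields.YangMills.Theorems.Prop7CombSymConjugation

end
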